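import Mathlib
import Literature.NumberTheory.Transcendental.ZagierDilogarithmConjecture
import Literature.NumberTheory.Transcendental.BlochWignerDilogarithm
import Literature.NumberTheory.Transcendental.BlochWignerDilogarithmProofs
import Summits.KontsevichZagierPeriods.KontsevichZagierPeriods.Theorems.HyperbolicBlochZagierDilogarithmConjectureDehnRigidity
import Summits.KontsevichZagierPeriods.KontsevichZagierPeriods.Theorems.HyperbolicBlochZagierDilogarithmConjectureStubCyclotomicPrimeSectorIff
import HarnessLib

/-!
# `ZagierDilogarithmConjecture` (stmt-KontsevichZagierPeriods-10550) — line `kummer-clausen-linearisation`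
(reshape c5, "the cyclotomic tower and the abelian sector"), stub `stub_milnorFive_iff_irrational`

**Milnor's conjecture at level 5 is ONE irrationality statement.** Let `ζ = ζ₅ = e^{2πi/5}` and let
`D` be the Bloch–Wigner dilogarithm (`blochWignerDilog`). The line's `ℤ`-form of Milnor's conjecture at
level `N` (Milnor 1982, Appendix) asks that every `m : ℤ/N → ℤ` supported on the residues `c` that are
units with `0 < c < N/2` and satisfying `Σ_c m_c D(ζ_N^c) = 0` vanishes identically. At level `5` the
admissible residues are exactly `{1, 2}`, so the statement is the `ℤ`-independence of the two positive
reals `D(ζ)`, `D(ζ²)` (`D > 0` on the upper half plane, `blochWignerDilog_pos`, and `ζ, ζ² ∈ ℍ⁺`), i.e.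
the irrationality of `D(ζ²)/D(ζ) = Cl₂(4π/5)/Cl₂(2π/5)` — the first open case of the Galois
propagation over `ℚ(ζ₅)` (`r₂ = 2`).

Proof. `⇒`: if `D(ζ²)/D(ζ) = a/b` with `b ≠ 0`, then `b·D(ζ²) − a·D(ζ) = 0` is an admissible relation
(`m₁ = −a`, `m₂ = b`, `m = 0` elsewhere), so Milnor forces `b = 0`, absurd. `⇐`: an admissible `m` is
supported on `{1, 2}` and its relation reads `m₁ D(ζ) + m₂ D(ζ²) = 0`; if `m₂ ≠ 0` then
`D(ζ²)/D(ζ) = −m₁/m₂ ∈ ℚ`, contradiction, so `m₂ = 0`, and then `m₁ D(ζ) = 0` with `D(ζ) > 0` gives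
`m₁ = 0`. Sorry-free; axioms ⊆ {propext, Classical.choice, Quot.sound}.

## References

* J. Milnor, *Hyperbolic geometry: the first 150 years*, Bull. AMS 6 (1982), Appendix (the conjecture
  on the values `Л(πc/N)`). [Milnor1982]
-/

noncomputable section

open scoped BigOperators ComplexConjugate
open Literature.NumberTheory.Transcendental

namespace Summit.KontsevichZagierPeriods.HyperbolicBloch.ZagierDilogarithmCyclotomic

open Summit.KontsevichZagierPeriods.HyperbolicBloch.ZagierDilogarithm (blochWignerDilog_pos)

namespace MilnorFive

/-- `D(ζ₅^c) > 0` for `0 < c < 5/2`: `ζ₅^c` lies in the open upper half plane, where the Bloch–Wigner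
dilogarithm is positive. [cite: Milnor1982, Appendix, Lemma 2] -/
theorem blochWignerDilog_zeta_pow_pos {c : ℕ} (hc0 : 0 < c) (hc2 : 2 * c < 5) :
    0 < blochWignerDilog (Complex.exp (2 * Real.pi * Complex.I / 5) ^ c) := by
  have h := CyclotomicPrimeSector.zeta_pow_im_pos 5 hc0 hc2
  simp only [Nat.cast_ofNat] at h
  exact blochWignerDilog_pos h

/-- The residues `c mod 5` with `0 < c < 5/2` are `1` and `2`. [folklore] -/
theorem eq_one_or_eq_two {c : ZMod 5} (h0 : 0 < c.val) (h2 : 2 * c.val < 5) : c = 1 ∨ c = 2 := by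
  have h1 : (1 : ZMod 5).val = 1 := rfl
  have h2' : (2 : ZMod 5).val = 2 := rfl
  rcases (show c.val = 1 ∨ c.val = 2 by omega) with hv | hv
  · exact Or.inl (ZMod.val_injective 5 (hv.trans h1.symm))
  · exact Or.inr (ZMod.val_injective 5 (hv.trans h2'.symm))

/-- A sum `Σ_{c mod 5} m_c D(ζ₅^c)` with `m` supported on `{1, 2}` is `m₁ D(ζ₅) + m₂ D(ζ₅²)`.
[folklore] -/
theorem sum_eq_of_support (m : ZMod 5 → ℤ) (hm : ∀ c, m c ≠ 0 → c = 1 ∨ c = 2) :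
    ∑ c : ZMod 5, (m c : ℝ) *
        blochWignerDilog (Complex.exp (2 * Real.pi * Complex.I / 5) ^ c.val) =
      (m 1 : ℝ) * blochWignerDilog (Complex.exp (2 * Real.pi * Complex.I / 5)) +
        (m 2 : ℝ) * blochWignerDilog (Complex.exp (2 * Real.pi * Complex.I / 5) ^ 2) := by
  rw [Fintype.sum_eq_add (1 : ZMod 5) 2 (by decide)]
  · have h1 : (1 : ZMod 5).val = 1 := rfl
    have h2 : (2 : ZMod 5).val = 2 := rfl
    rw [h1, h2, pow_one]
  · rintro c ⟨hc1, hc2⟩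
    have h0 : m c = 0 := by
      by_contra h
      rcases hm c h with rfl | rfl
      · exact hc1 rfl
      · exact hc2 rfl
    rw [h0, Int.cast_zero, zero_mul]

end MilnorFive

/-- **Milnor's conjecture at level 5 is ONE irrationality statement** (stub
`stub_milnorFive_iff_irrational` of line `kummer-clausen-linearisation`). `(ℤ/5)ˣ ∩ (0, 5/2) = {1, 2}`
and `D > 0` on `ℍ⁺`, so Milnor_5 (the `ℤ`-independence of `D(ζ₅), D(ζ₅²)`) says exactly that
`D(ζ₅²)/D(ζ₅) = Cl₂(4π/5)/Cl₂(2π/5)` is irrational. [cite: Milnor1982, Appendix] -/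
theorem stub_milnorFive_iff_irrational :
    (∀ m : ZMod 5 → ℤ, (∀ c, m c ≠ 0 → IsUnit c ∧ 0 < c.val ∧ 2 * c.val < 5) →
          ∑ c : ZMod 5, (m c : ℝ) *
              blochWignerDilog (Complex.exp (2 * Real.pi * Complex.I / 5) ^ c.val) = 0 →
            ∀ c, m c = 0) ↔
      Irrational (blochWignerDilog (Complex.exp (2 * Real.pi * Complex.I / 5) ^ 2) /
        blochWignerDilog (Complex.exp (2 * Real.pi * Complex.I / 5))) := by
  have hD1 : 0 < blochWignerDilog (Complex.exp (2 * Real.pi * Complex.I / 5)) := by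
    have h := MilnorFive.blochWignerDilog_zeta_pow_pos (c := 1) one_pos (by norm_num)
    rwa [pow_one] at h
  have hD2 : 0 < blochWignerDilog (Complex.exp (2 * Real.pi * Complex.I / 5) ^ 2) :=
    MilnorFive.blochWignerDilog_zeta_pow_pos (c := 2) two_pos (by norm_num)
  constructor
  · intro hM
    rw [irrational_iff_ne_rational]
    intro a b hb hab
    rw [div_eq_div_iff hD1.ne' (Int.cast_ne_zero.2 hb)] at hab
    obtain ⟨m, hm1, hm2, hm0⟩ : ∃ m : ZMod 5 → ℤ, m 1 = -a ∧ m 2 = b ∧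
        ∀ c, c ≠ 1 → c ≠ 2 → m c = 0 := by
      refine ⟨fun c => if c = 1 then -a else if c = 2 then b else 0, ?_, ?_, ?_⟩
      · simp
      · have h21 : (2 : ZMod 5) ≠ 1 := by decide
        simp [h21]
      · intro c h1 h2
        simp [h1, h2]
    have hsupp' : ∀ c, m c ≠ 0 → c = 1 ∨ c = 2 := by
      intro c hc
      by_contra h
      push Not at h
      exact hc (hm0 c h.1 h.2)
    have hsupp : ∀ c, m c ≠ 0 → IsUnit c ∧ 0 < c.val ∧ 2 * c.val < 5 := by
      intro c hc
      rcases hsupp' c hc with rfl | rfl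
      · exact ⟨isUnit_one, by decide⟩
      · exact ⟨IsUnit.of_mul_eq_one (3 : ZMod 5) (by decide), by decide⟩
    have hsum : ∑ c : ZMod 5, (m c : ℝ) *
        blochWignerDilog (Complex.exp (2 * Real.pi * Complex.I / 5) ^ c.val) = 0 := by
      rw [MilnorFive.sum_eq_of_support m hsupp', hm1, hm2]
      push_cast
      linear_combination hab
    exact hb (hm2 ▸ hM m hsupp hsum 2)
  · intro hx m hsupp hsum
    have hsupp' : ∀ c, m c ≠ 0 → c = 1 ∨ c = 2 := fun c hc =>
      MilnorFive.eq_one_or_eq_two (hsupp c hc).2.1 (hsupp c hc).2.2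
    rw [MilnorFive.sum_eq_of_support m hsupp'] at hsum
    have hm2 : m 2 = 0 := by
      by_contra h2
      refine (irrational_iff_ne_rational _).1 hx (-m 1) (m 2) h2 ?_
      rw [div_eq_div_iff hD1.ne' (Int.cast_ne_zero.2 h2)]
      push_cast
      linear_combination hsum
    have hm1 : m 1 = 0 := by
      rw [hm2, Int.cast_zero, zero_mul, add_zero] at hsum
      rcases mul_eq_zero.1 hsum with h | h
      · exact_mod_cast h
      · exact absurd h hD1.ne'
    intro c
    by_contra hc
    rcases hsupp' c hc with rfl | rfl
    · exact hc hm1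
    · exact hc hm2

end Summit.KontsevichZagierPeriods.HyperbolicBloch.ZagierDilogarithmCyclotomic

end
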